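import Summits.RiemannHypothesis.RiemannHypothesis.Theorems.PfPersistenceM2IndexFrames
import Summits.RiemannHypothesis.RiemannHypothesis.Theorems.PfPersistenceM2ThresholdOpen
import Summits.RiemannHypothesis.RiemannHypothesis.Theorems.PfPersistenceM2EvenSectorIndexDichotomy
import Summits.RiemannHypothesis.RiemannHypothesis.Theorems.WeilGroundStateGroundStatesConvergeToXiEvenWitnessParity
import Summits.RiemannHypothesis.RiemannHypothesis.Theorems.WeilWindowFlowGronwallLeakageStrictAntiForm
import HarnessLib

/-!
# Parity decoupling of the window negative index

pub-rhpf M2 seat, generation 8 — long-odds MECHANISM SEARCH; no RH claims.  Labels: every `theorem`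
below is PROVED (Lean kernel), RH-free and unconditional; nothing here is evidence about `ζ`.

For a half-width `a` let `ind⁻_re(a)`, `ind⁻_ev(a)`, `ind⁻_od(a)` be the negative indices of `Re Q`
(`Q` = Weil's explicit-formula quadratic form) on real, even-real, odd-real Weil tests supported in
`[-a, a]` (`RealNegIndexAtLeast`, `EvenNegIndexAtLeast`, `OddNegIndexAtLeast`).  The tree already has the
easy direction `EvenNegIndexAtLeast m a → OddNegIndexAtLeast n a → RealNegIndexAtLeast (m + n) a`
(`realNegIndexAtLeast_add_of_even_odd`, parity sectors being `Q`-orthogonal).  This file proves the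
converse and hence the EXACT DECOUPLING, window by window:

* `RealNegIndexAtLeast.exists_even_odd` — `RealNegIndexAtLeast n a → ∃ i ≤ n, EvenNegIndexAtLeast i a ∧
  OddNegIndexAtLeast (n - i) a`: split a real negative `n`-frame into even and odd parts; `Re Q` of a
  real combination is `(even polar matrix) + (odd part)`; the index-subadditivity engine
  `exists_negFrame_nonnegFrame` gives an `i`-frame negative for the even parts and an independent
  `(n - i)`-frame on which the even form is `≥ 0`, hence the odd form `< 0`.
* `realNegIndexAtLeast_iff_exists_even_odd`, `setOf_realNegIndexAtLeast_eq_iUnion` — the real level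
  sets are finite unions of intersections of parity level sets.
* `iSup_realNegIndex_eq_add` — **`ind⁻_re(a) = ind⁻_ev(a) + ind⁻_od(a)` in `ℕ∞`, for every `a`**.
* `realNegIndexAtLeast_one_iff`, `realNegIndexAtLeast_two_iff`, `sInf_realNegIndexAtLeast_one_eq_min`
  (the first real threshold is the smaller parity threshold), and, with exactly one off-line quadruple,
  `realNegIndexAtLeast_two_iff_of_encard_eq_one` / `sInf_realNegIndexAtLeast_two_eq_max_of_encard_eq_one`
  (the full real index `2` appears exactly when the LATER parity level has switched on),
  `realNegIndexAtLeast_two_mul_iff_of_encard_eq` (top real level = both parities saturated).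

Consequence in words (DERIVED): the real threshold sequence is the sorted merge of the even and odd
threshold sequences; the real sector carries no information beyond the two parity sectors.  Whether any
threshold exists at all (`K ≥ 1`) is `¬ RH` and is untouched.
[cite: Bombieri2000Weil, §7 (even/odd splitting of the quadratic functional), Thm 8, Thm 9]
-/

open Finset Set Module
open scoped ComplexConjugate

namespace Summit.RiemannHypothesis.RiemannHypothesis.Theorems.PfPersistenceM2NegIndex

open Literature.NumberTheory.LFunctions
open Literature.NumberTheory.LFunctions.ZetaZeros
open Summit.RiemannHypothesis.RiemannHypothesis.Theorems.PfPersistenceParityIndex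

-- `𝒬` = the open quadrant of non-trivial zeros, `Re ρ > 1/2`, `Im ρ > 0` (one representative per
-- off-line quadruple); a NOTATION (not a definition), literally the set of the M2 files.
set_option quotPrecheck false in
local notation "𝒬" => {ρ : ℂ | ρ ∈ riemannZetaNontrivialZeros ∧ 1 / 2 < ρ.re ∧ 0 < ρ.im}

/-! ## A. Re-indexing a combination of combinations -/

/-- `∑ₗ dₗ (∑ᵢ vₗᵢ Fᵢ) = ∑ᵢ (∑ₗ dₗ vₗ)ᵢ Fᵢ` pointwise. [folklore] -/
theorem sum_mul_sum_mul_eq {k n : ℕ} (d : Fin k → ℝ) (v : Fin k → Fin n → ℝ) (F : Fin n → ℝ → ℂ)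
    (t : ℝ) : ∑ l, (d l : ℂ) * ∑ i, ((v l i : ℝ) : ℂ) * F i t =
      ∑ i, (((∑ l, d l • v l) i : ℝ) : ℂ) * F i t := by
  simp only [Finset.sum_apply, Pi.smul_apply, smul_eq_mul, Complex.ofReal_sum, Complex.ofReal_mul,
    Finset.sum_mul, Finset.mul_sum]
  rw [Finset.sum_comm]
  exact Finset.sum_congr rfl fun i _ ↦ Finset.sum_congr rfl fun l _ ↦ by ring

/-! ## B. The decoupling theorem -/

/-- **Parity decoupling (hard direction).**  `n` negative real directions on `[-a, a]` split as `i` negative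
EVEN directions and `n - i` negative ODD directions on the same window, for some `i ≤ n`.  RH-free,
unconditional. [cite: Bombieri2000Weil, §7, Thm 8, Thm 9] -/
theorem RealNegIndexAtLeast.exists_even_odd {n : ℕ} {a : ℝ} (h : RealNegIndexAtLeast n a) :
    ∃ i ≤ n, EvenNegIndexAtLeast i a ∧ OddNegIndexAtLeast (n - i) a := by
  classical
  obtain ⟨g, htest, hreal, hsupp, hneg⟩ := h
  -- even and odd parts of the family
  set E : Fin n → ℝ → ℂ := fun i t ↦ (g i t + g i (-t)) / 2 with hE
  set O : Fin n → ℝ → ℂ := fun i t ↦ (g i t - g i (-t)) / 2 with hO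
  have hEt : ∀ i, IsWeilTest (E i) := fun i ↦ (htest i).evenPart
  have hOt : ∀ i, IsWeilTest (O i) := fun i ↦ (htest i).oddPart
  have hEev : ∀ i (t : ℝ), E i (-t) = E i t := fun i t ↦ by
    simp only [hE, neg_neg]; ring
  have hOod : ∀ i (t : ℝ), O i (-t) = -O i t := fun i t ↦ by
    simp only [hO, neg_neg]; ring
  have hEr : ∀ i (t : ℝ), (E i t).im = 0 := fun i t ↦ by
    simp [hE, Complex.add_im, hreal]
  have hOr : ∀ i (t : ℝ), (O i t).im = 0 := fun i t ↦ by
    simp [hO, Complex.sub_im, hreal]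
  have hEs : ∀ i, tsupport (E i) ⊆ Icc (-a) a := fun i ↦
    GroundStatesConvergeToXi.tsupport_evenPart_subset_Icc (hsupp i)
  have hOs : ∀ i, tsupport (O i) ⊆ Icc (-a) a := fun i ↦
    GroundStatesConvergeToXi.tsupport_oddPart_subset_Icc (hsupp i)
  -- `Re Q` on real combinations splits along the parity decomposition
  have hsplit : ∀ c : Fin n → ℝ, (weilQuadratic (fun t : ℝ ↦ ∑ i, (c i : ℂ) * g i t)).re =
      (weilQuadratic (fun t : ℝ ↦ ∑ i, (c i : ℂ) * E i t)).re +
        (weilQuadratic (fun t : ℝ ↦ ∑ i, (c i : ℂ) * O i t)).re := by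
    intro c
    have e : (fun t : ℝ ↦ ∑ i, (c i : ℂ) * g i t) =
        fun t : ℝ ↦ (∑ i, (c i : ℂ) * E i t) + ∑ i, (c i : ℂ) * O i t := by
      funext t
      rw [← Finset.sum_add_distrib]
      exact Finset.sum_congr rfl fun i _ ↦ by simp only [hE, hO]; ring
    rw [e]
    exact re_weilQuadratic_add_of_even_odd (isWeilTest_combination E hEt c)
      (isWeilTest_combination O hOt c) (fun t ↦ by simp only [hEev])
      (fun t ↦ by simp only [hOod, mul_neg, Finset.sum_neg_distrib])
      (fun t ↦ by simp [Complex.im_sum, Complex.mul_im, hEr])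
      (fun t ↦ by simp [Complex.im_sum, Complex.mul_im, hOr])
  -- the polar matrix of `Re Q` on the even parts
  set M : Matrix (Fin n) (Fin n) ℝ := fun i j ↦ (1 / 2) *
    ((weilQuadratic (E i + E j)).re - (weilQuadratic (E i)).re - (weilQuadratic (E j)).re) with hM
  have hMs : M.IsSymm := Matrix.IsSymm.ext fun i j ↦ by
    simp only [hM]
    rw [add_comm (E j) (E i)]
    ring
  have hqE : ∀ c : Fin n → ℝ, (weilQuadratic (fun t : ℝ ↦ ∑ i, (c i : ℂ) * E i t)).re =
      Matrix.toBilin' M c c := by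
    intro c
    rw [Matrix.toBilin'_apply, re_weilQuadratic_sum_real_mul Finset.univ hEt c, Finset.mul_sum]
    refine Finset.sum_congr rfl fun i _ ↦ ?_
    rw [Finset.mul_sum]
    refine Finset.sum_congr rfl fun j _ ↦ ?_
    simp only [hM]
    ring
  -- the index-subadditivity engine
  obtain ⟨i, hi, u, w, hu, hw, hw0⟩ := exists_negFrame_nonnegFrame M hMs
  refine ⟨i, hi, ?_, ?_⟩
  · -- even frame: `E'ₖ = ∑ᵢ uₖᵢ Eᵢ`
    refine ⟨fun k t ↦ ∑ j, ((u k j : ℝ) : ℂ) * E j t, fun k ↦ isWeilTest_combination E hEt (u k),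
      fun k t ↦ by simp only [hEev], fun k t ↦ by simp [Complex.im_sum, Complex.mul_im, hEr],
      fun k ↦ WeilWindowFlowGronwallLeakage.tsupport_sum_real_mul_subset Finset.univ hEs (u k),
      fun d hd ↦ ?_⟩
    have e : (fun t : ℝ ↦ ∑ k, (d k : ℂ) * ∑ j, ((u k j : ℝ) : ℂ) * E j t) =
        fun t : ℝ ↦ ∑ j, (((∑ k, d k • u k) j : ℝ) : ℂ) * E j t :=
      funext fun t ↦ sum_mul_sum_mul_eq d u E t
    rw [e, hqE]
    exact hu d hd
  · -- odd frame: `O'ₗ = ∑ᵢ wₗᵢ Oᵢ`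
    refine ⟨fun l t ↦ ∑ j, ((w l j : ℝ) : ℂ) * O j t, fun l ↦ isWeilTest_combination O hOt (w l),
      fun l t ↦ by simp only [hOod, mul_neg, Finset.sum_neg_distrib],
      fun l t ↦ by simp [Complex.im_sum, Complex.mul_im, hOr],
      fun l ↦ WeilWindowFlowGronwallLeakage.tsupport_sum_real_mul_subset Finset.univ hOs (w l),
      fun d hd ↦ ?_⟩
    have e : (fun t : ℝ ↦ ∑ l, (d l : ℂ) * ∑ j, ((w l j : ℝ) : ℂ) * O j t) =
        fun t : ℝ ↦ ∑ j, (((∑ l, d l • w l) j : ℝ) : ℂ) * O j t :=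
      funext fun t ↦ sum_mul_sum_mul_eq d w O t
    rw [e]
    set c : Fin n → ℝ := ∑ l, d l • w l with hc
    have hc0 : c ≠ 0 := hw d hd
    have h1 := hsplit c
    have h2 := hneg c hc0
    have h3 := hw0 d
    rw [hqE] at h1
    linarith

/-- **Parity decoupling (iff form).** RH-free. [cite: Bombieri2000Weil, §7, Thm 8, Thm 9] -/
theorem realNegIndexAtLeast_iff_exists_even_odd (n : ℕ) (a : ℝ) :
    RealNegIndexAtLeast n a ↔ ∃ i ≤ n, EvenNegIndexAtLeast i a ∧ OddNegIndexAtLeast (n - i) a := by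
  refine ⟨RealNegIndexAtLeast.exists_even_odd, ?_⟩
  rintro ⟨i, hi, hev, hod⟩
  have h := realNegIndexAtLeast_add_of_even_odd hev hod
  rwa [Nat.add_sub_cancel' hi] at h

/-- The real level sets are finite unions of intersections of parity level sets. RH-free. [folklore] -/
theorem setOf_realNegIndexAtLeast_eq_iUnion (n : ℕ) :
    {a : ℝ | RealNegIndexAtLeast n a} =
      ⋃ (i : ℕ) (_ : i ≤ n), ({a : ℝ | EvenNegIndexAtLeast i a} ∩ {a : ℝ | OddNegIndexAtLeast (n - i) a}) := by
  ext a
  simp only [mem_setOf_eq, mem_iUnion, mem_inter_iff, exists_prop, realNegIndexAtLeast_iff_exists_even_odd]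

/-! ## C. The window index is additive over parity: `ind⁻_re(a) = ind⁻_ev(a) + ind⁻_od(a)` -/

/-- Level `0` is trivial in the odd sector (the empty family). [folklore] -/
theorem oddNegIndexAtLeast_zero (a : ℝ) : OddNegIndexAtLeast 0 a :=
  ⟨fun i ↦ i.elim0, fun i ↦ i.elim0, fun i ↦ i.elim0, fun i ↦ i.elim0, fun i ↦ i.elim0,
    fun c hc ↦ absurd (Subsingleton.elim c 0) hc⟩

/-- **`ind⁻_re(a) = ind⁻_ev(a) + ind⁻_od(a)` for every half-width `a`** (indices in `ℕ∞`, as iterated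
suprema of the attained levels).  RH-free, unconditional. [cite: Bombieri2000Weil, §7, Thm 8, Thm 9] -/
theorem iSup_realNegIndex_eq_add (a : ℝ) :
    (⨆ n : ℕ, ⨆ _ : RealNegIndexAtLeast n a, (n : ℕ∞)) =
      (⨆ n : ℕ, ⨆ _ : EvenNegIndexAtLeast n a, (n : ℕ∞)) +
        ⨆ n : ℕ, ⨆ _ : OddNegIndexAtLeast n a, (n : ℕ∞) := by
  apply le_antisymm
  · refine iSup₂_le fun n hn ↦ ?_
    obtain ⟨i, hi, hev, hod⟩ := hn.exists_even_odd
    have hcast : (n : ℕ∞) = (i : ℕ∞) + ((n - i : ℕ) : ℕ∞) := by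
      rw [← Nat.cast_add, Nat.add_sub_cancel' hi]
    rw [hcast]
    exact add_le_add (le_iSup₂_of_le i hev le_rfl) (le_iSup₂_of_le (n - i) hod le_rfl)
  · refine ENat.biSup_add_biSup_le' ⟨0, evenNegIndexAtLeast_zero a⟩ ⟨0, oddNegIndexAtLeast_zero a⟩
      fun i hi j hj ↦ ?_
    rw [← Nat.cast_add]
    exact le_iSup₂_of_le (i + j) (realNegIndexAtLeast_add_of_even_odd hi hj) le_rfl

/-! ## D. Low levels and thresholds -/

/-- Level one: a negative real direction on `[-a, a]` is a negative even OR a negative odd direction.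
RH-free. [cite: Bombieri2000Weil, §7, Thm 8] -/
theorem realNegIndexAtLeast_one_iff (a : ℝ) :
    RealNegIndexAtLeast 1 a ↔ EvenNegIndexAtLeast 1 a ∨ OddNegIndexAtLeast 1 a := by
  rw [realNegIndexAtLeast_iff_exists_even_odd]
  constructor
  · rintro ⟨i, hi, hev, hod⟩
    interval_cases i
    · exact Or.inr hod
    · exact Or.inl hev
  · rintro (hev | hod)
    · exact ⟨1, le_rfl, hev, oddNegIndexAtLeast_zero a⟩
    · exact ⟨0, zero_le_one, evenNegIndexAtLeast_zero a, hod⟩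

/-- Level two: `ind⁻_re(a) ≥ 2` iff `ind⁻_ev(a) ≥ 2` or (`ind⁻_ev(a) ≥ 1` and `ind⁻_od(a) ≥ 1`) or
`ind⁻_od(a) ≥ 2`.  RH-free. [cite: Bombieri2000Weil, §7, Thm 8] -/
theorem realNegIndexAtLeast_two_iff (a : ℝ) :
    RealNegIndexAtLeast 2 a ↔ EvenNegIndexAtLeast 2 a ∨
      (EvenNegIndexAtLeast 1 a ∧ OddNegIndexAtLeast 1 a) ∨ OddNegIndexAtLeast 2 a := by
  rw [realNegIndexAtLeast_iff_exists_even_odd]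
  constructor
  · rintro ⟨i, hi, hev, hod⟩
    interval_cases i
    · exact Or.inr (Or.inr hod)
    · exact Or.inr (Or.inl ⟨hev, hod⟩)
    · exact Or.inl hev
  · rintro (hev | ⟨hev, hod⟩ | hod)
    · exact ⟨2, le_rfl, hev, oddNegIndexAtLeast_zero a⟩
    · exact ⟨1, one_le_two, hev, hod⟩
    · exact ⟨0, zero_le_two, evenNegIndexAtLeast_zero a, hod⟩

/-- **The first real threshold is the smaller of the two parity thresholds**:
`inf {a | ind⁻_re(a) ≥ 1} = min (inf {a | ind⁻_ev(a) ≥ 1}) (inf {a | ind⁻_od(a) ≥ 1})` (all three sets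
are empty iff `K = 0`, i.e. under RH, where both sides are the junk value `0`).  RH-free.
[cite: Bombieri2000Weil, §7, Thm 8, Thm 9] -/
theorem sInf_realNegIndexAtLeast_one_eq_min :
    sInf {a : ℝ | RealNegIndexAtLeast 1 a} =
      min (sInf {a : ℝ | EvenNegIndexAtLeast 1 a}) (sInf {a : ℝ | OddNegIndexAtLeast 1 a}) := by
  have hset : {a : ℝ | RealNegIndexAtLeast 1 a} =
      {a : ℝ | EvenNegIndexAtLeast 1 a} ∪ {a : ℝ | OddNegIndexAtLeast 1 a} := by
    ext a
    simp only [mem_setOf_eq, mem_union, realNegIndexAtLeast_one_iff]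
  rw [hset]
  by_cases hK : ((0 + 1 : ℕ) : ℕ∞) ≤ Set.encard 𝒬
  · exact csInf_union (bddBelow_setOf_evenNegIndexAtLeast_succ 0)
      ((exists_evenNegIndexAtLeast_iff_encard 1).2 (by simpa using hK))
      (bddBelow_setOf_oddNegIndexAtLeast_succ 0)
      ((exists_oddNegIndexAtLeast_iff_encard 1).2 (by simpa using hK))
  · have hev : {a : ℝ | EvenNegIndexAtLeast 1 a} = ∅ := Set.eq_empty_iff_forall_notMem.2 fun a ha ↦
      hK (by simpa using le_encard_quadrant_of_evenNegIndexAtLeast ha)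
    have hod : {a : ℝ | OddNegIndexAtLeast 1 a} = ∅ := Set.eq_empty_iff_forall_notMem.2 fun a ha ↦
      hK (by simpa using le_encard_quadrant_of_oddNegIndexAtLeast ha)
    rw [hev, hod, Set.union_empty, min_self]

/-- **Top real level = both parities saturated**: with exactly `k` off-line quadruples,
`ind⁻_re(a) ≥ 2k ⟺ ind⁻_ev(a) ≥ k ∧ ind⁻_od(a) ≥ k`.  RH-free. [cite: Bombieri2000Weil, Thm 8, Thm 9] -/
theorem realNegIndexAtLeast_two_mul_iff_of_encard_eq {k : ℕ} (hK : Set.encard 𝒬 = k) (a : ℝ) :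
    RealNegIndexAtLeast (2 * k) a ↔ EvenNegIndexAtLeast k a ∧ OddNegIndexAtLeast k a := by
  constructor
  · intro h
    obtain ⟨i, hi, hev, hod⟩ := h.exists_even_odd
    have h1 : (i : ℕ∞) ≤ k := hK ▸ le_encard_quadrant_of_evenNegIndexAtLeast hev
    have h2 : ((2 * k - i : ℕ) : ℕ∞) ≤ k := hK ▸ le_encard_quadrant_of_oddNegIndexAtLeast hod
    have h1' : i ≤ k := by exact_mod_cast h1
    have h2' : 2 * k - i ≤ k := by exact_mod_cast h2
    have hik : i = k := by omega
    subst hik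
    have h2k : 2 * i - i = i := by omega
    rw [h2k] at hod
    exact ⟨hev, hod⟩
  · rintro ⟨hev, hod⟩
    have h := realNegIndexAtLeast_add_of_even_odd hev hod
    rwa [← two_mul] at h

/-- **One off-line quadruple: the full real index `2` appears exactly when BOTH parity levels have switched
on** (`ind⁻_re(a) ≥ 2 ⟺ ind⁻_ev(a) ≥ 1 ∧ ind⁻_od(a) ≥ 1` when `K = 1`).  RH-free.
[cite: Bombieri2000Weil, Thm 8, Thm 9] -/
theorem realNegIndexAtLeast_two_iff_of_encard_eq_one (hK : Set.encard 𝒬 = 1) (a : ℝ) :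
    RealNegIndexAtLeast 2 a ↔ EvenNegIndexAtLeast 1 a ∧ OddNegIndexAtLeast 1 a := by
  simpa using realNegIndexAtLeast_two_mul_iff_of_encard_eq (k := 1) (by simpa using hK) a

/-- … and then the second real threshold is the LATER of the two parity thresholds:
`inf {a | ind⁻_re(a) ≥ 2} = max (inf {a | ind⁻_ev(a) ≥ 1}) (inf {a | ind⁻_od(a) ≥ 1})` when `K = 1`.
RH-free (the hypothesis `K = 1` is a binder; no claim that it holds). [cite: Bombieri2000Weil, §4 Thm 5, Thm 8, Thm 9] -/
theorem sInf_realNegIndexAtLeast_two_eq_max_of_encard_eq_one (hK : Set.encard 𝒬 = 1) :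
    sInf {a : ℝ | RealNegIndexAtLeast 2 a} =
      max (sInf {a : ℝ | EvenNegIndexAtLeast 1 a}) (sInf {a : ℝ | OddNegIndexAtLeast 1 a}) := by
  have hK1 : ((0 + 1 : ℕ) : ℕ∞) ≤ Set.encard 𝒬 := by rw [hK]; simp
  set e := sInf {a : ℝ | EvenNegIndexAtLeast 1 a} with he
  set o := sInf {a : ℝ | OddNegIndexAtLeast 1 a} with ho
  have hset : {a : ℝ | RealNegIndexAtLeast 2 a} = Ioi (max e o) := by
    ext a
    rw [mem_setOf_eq, realNegIndexAtLeast_two_iff_of_encard_eq_one hK, Set.mem_Ioi, max_lt_iff,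
      evenNegIndexAtLeast_succ_iff_sInf_lt hK1, oddNegIndexAtLeast_succ_iff_sInf_lt hK1]
  rw [hset, csInf_Ioi]

end Summit.RiemannHypothesis.RiemannHypothesis.Theorems.PfPersistenceM2NegIndex
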